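import Summits.QuantumFields.YangMills.Theorems.BalabanUVNodesN15KingModelFullPropagatorGradOperator
import Summits.QuantumFields.YangMills.Theorems.BalabanUVNodesN15KingModelFullPropagatorGradTransposeRate

/-!
# BalabanUVNodes ∕ N15 — THE KING-MODEL RUNG, CURVED EDITION (PART Q4a): THE (3.42) ENTRIES `|∇_U Gλ|` AND `|G∇*_U λ|` OF THE TWO-SPACING PAIR
# OF KING'S FULL `A = 0` PROPAGATOR, PRINTED SHAPE — for EVERY η-lattice source `λ` (refined to the η′-lattice through King's pairing):
# `|∂^{η′}_μ(A₀′⁻¹(λ∘π))(x′) − (∂^η_μA₀⁻¹λ)(x)|, |(A₀′⁻¹∇′*_μ(λ∘π))(x′) − (A₀⁻¹∇*_μλ)(x)| ≤ C·(L^{−γ∕2})^K·e^{−δ·dist(B(x), supp λ)}·‖λ‖_∞`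
# (Track A, DAG node N15 = NE2; FAN-OUT v1.1 §N15 s3 «KING-MODEL RUNG …»; PART Q = NE2⁰'s OPERATOR LAYER ((3.42) sup entries) for King's full
# propagator with genuine η-lattice test functions)

HONEST FRAMING.  Count-neutral kernel bookkeeping (cell `pub-ymgap`, seat `pub-ymgap-dag-n15-e` g7; `--supports stmt-QuantumFields-20292 --as helper`
= K3⁗ `SpineGivenEndpointR13Sep`).  TEMPLATE LITERATURE, `A = 0`: C. King's scalar U(1)-Higgs MODEL on finite tori ([King1986] (2.13)–(2.17) p. 653,
Theorem 3.3 (3.7) p. 658, Prop. 3.8 (3.71) p. 664, p. 664 «x′ ∈ B^n(x)»; [Ba 4] (1.6), (1.10)), NOT Bałaban's covariant objects; the statements are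
(2.17)-summed SHAPES of (3.7) + (3.71) in [B9]'s (3.42)-entry currency at `U ≡ 1`, not printed propositions; NE2⁺ NOT PRINTED ∕ not proved; NOT a
node discharge; nothing continuum ∕ ℝ⁴ ∕ OS ∕ mass-gap ∕ Clay.  0 `sorry`, 0 `def`, standard axioms.

THE POINT.  Part P″ read PART P′ at the source `λ∘π` (entry `|Gλ|`).  THIS FILE reads PART Q2b (gradient) and PART Q3b (transposed gradient)
the same way, and supplies the summation-by-parts dictionary turning the transposed gradient into [B9]'s third entry `G∇*λ`:
* §1 `fineOp_inv_transpose`, `constrainedProp_symm` — `A₀` is symmetric (`King1986.Torus.fineOp_transpose`), hence so are `A₀⁻¹` and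
  `G^η_K = N^{d+1}·A₀⁻¹`;
* §2 `inv_mulVec_adjDeriv_eq_sum` — SUMMATION BY PARTS + SYMMETRY: with the adjoint η-derivative `(∇*_μλ)(y) = N·(λ(y − e_μ) − λ(y))` (the
  `ℓ²(η^{d+1})`-adjoint of the forward derivative `∂^η_μ`), `(A₀⁻¹∇*_μλ)(x) = Σ_y N^{−(d+1)}·N·(G^η_K(y + e_μ, x) − G^η_K(y, x))·λ(y)` — the
  transposed-gradient operator of PARTS Q3a∕Q3b;  `inv_deriv_mulVec_eq_sum` — `N·((A₀⁻¹λ)(x + e_μ) − (A₀⁻¹λ)(x)) = Σ_y N^{−(d+1)}·N·(G(x + e_μ, y)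
  − G(x, y))·λ(y)` (part P″ `inv_mulVec_eq_sum` twice);
* §3 ★ **`fullPropDOp_rate_printed`** (entry `|∇Gλ|`) and ★ **`fullPropAdjOp_rate_printed`** (entry `|G∇*λ|`): for odd `L ≥ 3`, `a > 0`, `m₀² ≥ 0`,
  `0 ≤ γ < 1`: `∃ C δ > 0` such that for EVERY `K, n ≥ 1`, cube `2L^e`, `0 < m² ≤ m₀²`, `μ`, every `λ` on the η-lattice with `|λ| ≤ F`, every `D ∈ ℕ`
  and fine `x′` with `λ(y) = 0` whenever `|B(x) − B(y)|_M < D` (`x = πx′`), the displayed differences are `≤ C·(L^{−γ∕2})^K·e^{−δD}·F`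
  (PART Q2b ∕ Q3b at `f′ = λ∘π` + §2 + part P″ `sum_comp_underPtN`).
WHAT THE CURVED CASE ADDS (one line): Bałaban's `∇_U G_k(U)λ`, `G_k(U)∇*_Uλ` uniformly over the live window `Reg335`; print gives analyticity in
`U` and η-uniformity (Thm 3.4), never an η-difference.
HONEST SCOPE.  (i) `A = 0`, periodic b.c., odd `L ≥ 3`, `0 < m² ≤ m₀²`, cubes `2L^e`, `K, n ≥ 1`, `0 ≤ γ < 1`; (ii) `∇*` is the adjoint of the
forward η-derivative for the `η^{d+1}`-weighted pairing (at `U ≡ 1` Bałaban's `∇*_U` IS this); (iii) block-distance currency; not Bałaban's covariant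
entries; not a discharge.
Locators: [King1986] C. King, CMP **102** (1986) 649–677: (2.13)–(2.17) p. 653, Theorem 3.3 (3.7) p. 658, Prop. 3.8 (3.71) p. 664; [Ba 4] =
[Balaban1983RegularityDecay] (1.6) p. 572, Theorem (1.10) p. 573; [B9] = [Balaban1985BackgroundPropagators] Thm 3.1 (3.42) p. 397 + Thm 3.14
pp. 426–427 (typing template).
-/

noncomputable section

namespace Summit.QuantumFields.YangMills.BalabanUVNodes.N15KingModelRung.Curved

open Real Finset Matrix
open Literature.MathematicalPhysics.QuantumFieldTheory.Balaban1983to89.B5Prop11Plancherel (Tor fine unitVec)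
open Literature.MathematicalPhysics.QuantumFieldTheory.King1986 (aK aK_pos)
open Literature.MathematicalPhysics.QuantumFieldTheory.King1986.Torus (constrainedProp fineOp blockOf tdistT fineOp_transpose tdistT_nonneg)

variable {d : ℕ} (L : ℕ) [NeZero L]

/-! ## §1 Symmetry of the propagator -/

omit [NeZero L] in
/-- `A₀⁻¹` is symmetric (`A₀` is: `fineOp_transpose`). [cite: King1986, (4.1)–(4.5) p.670; Balaban1983RegularityDecay, (1.6) p.572] -/
theorem fineOp_inv_transpose (N : ℕ) [NeZero N] (M : Fin (d + 1) → ℕ) [∀ μ, NeZero (M μ)] (a c m2 : ℝ) :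
    ((fineOp N M a c m2)⁻¹)ᵀ = (fineOp N M a c m2)⁻¹ := by
  rw [Matrix.transpose_nonsing_inv, fineOp_transpose]

omit [NeZero L] in
/-- **`G^η_K` is symmetric**: `G(x, y) = G(y, x)` (`G = N^{d+1}·A₀⁻¹`). [cite: King1986, (2.13) p.653, (4.44) p.675] -/
theorem constrainedProp_symm (N : ℕ) [NeZero N] (M : Fin (d + 1) → ℕ) [∀ μ, NeZero (M μ)] (a c m2 : ℝ) (x y : Tor (fine N M)) :
    constrainedProp N M a c m2 x y = constrainedProp N M a c m2 y x := by
  rw [constrainedProp, Matrix.smul_apply, Matrix.smul_apply]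
  congr 1
  rw [← Matrix.transpose_apply ((fineOp N M a c m2)⁻¹) x y, fineOp_inv_transpose]

/-! ## §2 Summation by parts: `A₀⁻¹∇*_μ` is the transposed gradient -/

omit [NeZero L] in
/-- **`N·((A₀⁻¹λ)(x + e_μ) − (A₀⁻¹λ)(x)) = Σ_y N^{−(d+1)}·N·(G(x + e_μ, y) − G(x, y))·λ(y)`** — the forward η-derivative of `A₀⁻¹λ` as the gradient
kernel against `λ` in the fine measure (part P″ `inv_mulVec_eq_sum` twice). [cite: King1986, (2.13) p.653, Theorem 3.3 (3.7) p.658] -/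
theorem inv_deriv_mulVec_eq_sum (N : ℕ) [NeZero N] (M : Fin (d + 1) → ℕ) [∀ μ, NeZero (M μ)] (a c m2 : ℝ)
    (lam : Tor (fine N M) → ℝ) (x : Tor (fine N M)) (μ : Fin (d + 1)) :
    (N : ℝ) * (((fineOp N M a c m2)⁻¹ *ᵥ lam) (x + unitVec (fine N M) μ) - ((fineOp N M a c m2)⁻¹ *ᵥ lam) x)
      = ∑ y, ((N : ℝ) ^ (d + 1))⁻¹ * ((N : ℝ) * (constrainedProp N M a c m2 (x + unitVec (fine N M) μ) y
          - constrainedProp N M a c m2 x y)) * lam y := by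
  rw [inv_mulVec_eq_sum N M a c m2 lam, inv_mulVec_eq_sum N M a c m2 lam, ← Finset.sum_sub_distrib, Finset.mul_sum]
  refine Finset.sum_congr rfl fun y _ => ?_
  ring

omit [NeZero L] in
/-- **SUMMATION BY PARTS + SYMMETRY**: with `(∇*_μλ)(y) = N·(λ(y − e_μ) − λ(y))` the `ℓ²(η^{d+1})`-adjoint of the forward η-derivative,
`(A₀⁻¹∇*_μλ)(x) = Σ_y N^{−(d+1)}·N·(G(y + e_μ, x) − G(y, x))·λ(y)` — Bałaban's entry `G∇*λ` at `U ≡ 1` IS the transposed-gradient operator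
(shift of the summation variable `y ↦ y + e_μ`, then `G(x, y + e_μ) = G(y + e_μ, x)`).
[cite: Balaban1985BackgroundPropagators, (3.42) p.397 (the entry `G(U)∇*_Uλ`); King1986, (2.13) p.653] -/
theorem inv_mulVec_adjDeriv_eq_sum (N : ℕ) [NeZero N] (M : Fin (d + 1) → ℕ) [∀ μ, NeZero (M μ)] (a c m2 : ℝ)
    (lam : Tor (fine N M) → ℝ) (x : Tor (fine N M)) (μ : Fin (d + 1)) :
    ((fineOp N M a c m2)⁻¹ *ᵥ (fun y => (N : ℝ) * (lam (y - unitVec (fine N M) μ) - lam y))) x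
      = ∑ y, ((N : ℝ) ^ (d + 1))⁻¹ * ((N : ℝ) * (constrainedProp N M a c m2 (y + unitVec (fine N M) μ) x
          - constrainedProp N M a c m2 y x)) * lam y := by
  have hN : ((N : ℝ) ^ (d + 1)) ≠ 0 := pow_ne_zero _ (by exact_mod_cast NeZero.ne N)
  set A := (fineOp N M a c m2)⁻¹ with hA
  -- the kernel of `A₀⁻¹` in the fine measure, and its symmetry
  have hker : ∀ u v, A u v = ((N : ℝ) ^ (d + 1))⁻¹ * constrainedProp N M a c m2 v u := by
    intro u v
    rw [constrainedProp_symm, constrainedProp, Matrix.smul_apply, smul_eq_mul, ← mul_assoc, inv_mul_cancel₀ hN, one_mul]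
  rw [Matrix.mulVec, dotProduct]
  -- split, shift the first sum by `e_μ`
  have hsplit : ∑ y, A x y * ((N : ℝ) * (lam (y - unitVec (fine N M) μ) - lam y))
      = (N : ℝ) * (∑ y, A x y * lam (y - unitVec (fine N M) μ)) - (N : ℝ) * ∑ y, A x y * lam y := by
    rw [Finset.mul_sum, Finset.mul_sum, ← Finset.sum_sub_distrib]
    exact Finset.sum_congr rfl fun y _ => by ring
  have hshift : ∑ y, A x y * lam (y - unitVec (fine N M) μ) = ∑ y, A x (y + unitVec (fine N M) μ) * lam y := by
    rw [← Equiv.sum_comp (Equiv.addRight (unitVec (fine N M) μ)) (fun y => A x y * lam (y - unitVec (fine N M) μ))]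
    refine Finset.sum_congr rfl fun y _ => ?_
    simp only [Equiv.coe_addRight, add_sub_cancel_right]
  rw [hsplit, hshift, Finset.mul_sum, Finset.mul_sum, ← Finset.sum_sub_distrib]
  refine Finset.sum_congr rfl fun y _ => ?_
  rw [hker x (y + unitVec (fine N M) μ), hker x y]
  ring

/-! ## §3 The printed shapes of the two gradient entries of the pair -/

/-- ★ **ENTRY `|∇Gλ|` OF THE PAIR, PRINTED SHAPE**: for odd `L ≥ 3`, `a > 0`, a mass cap `m₀² ≥ 0` and `0 ≤ γ < 1` there are `C, δ > 0` such that for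
EVERY `K ≥ 1`, `n ≥ 1`, cube `M_μ = 2L^e`, mass `0 < m² ≤ m₀²`, direction `μ`, every `λ` on the η-lattice with `|λ| ≤ F`, every `D ∈ ℕ` and fine point
`x′` with `λ(y) = 0` whenever `|B(x) − B(y)|_M < D` (`x = πx′`):
`|L^nL^K·((A₀′⁻¹(λ∘π))(x′ + e_μ) − (A₀′⁻¹(λ∘π))(x′)) − L^K·((A₀⁻¹λ)(x + e_μ) − (A₀⁻¹λ)(x))| ≤ C·(L^{−γ∕2})^K·e^{−δD}·F` — Theorem 3.3 (3.7)'s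
gradient clause WITH Prop. 3.8's two-spacing rate, for the FULL `A = 0` fluctuation propagator as an operator on η-lattice sources (PART Q2b at `f′ =
λ∘π`; §2; part P″ `sum_comp_underPtN`). [cite: King1986, Theorem 3.3 (3.7) p.658, Prop. 3.8 (3.71) p.664, p.664; Balaban1983RegularityDecay, Theorem (1.10) p.573; Balaban1985BackgroundPropagators, Thm 3.1 (3.42) p.397 (entry shape)] -/
theorem fullPropDOp_rate_printed (hLodd : Odd L) (hL : 2 ≤ L) {a : ℝ} (ha : 0 < a) {m0sq : ℝ} (hm0 : 0 ≤ m0sq) {γ : ℝ}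
    (hγ0 : 0 ≤ γ) (hγ1 : γ < 1) :
    ∃ C δ : ℝ, 0 < C ∧ 0 < δ ∧ ∀ (K : ℕ), 1 ≤ K → ∀ (n : ℕ), 1 ≤ n →
      ∀ (e : ℕ) (M : Fin (d + 1) → ℕ) [∀ μ, NeZero (M μ)], (∀ μ, M μ = 2 * L ^ e) →
      ∀ (msq : ℝ), 0 < msq → msq ≤ m0sq → ∀ (μ : Fin (d + 1))
      (lam : Tor (fine (L ^ K) M) → ℝ) (F : ℝ), (∀ y, |lam y| ≤ F) → ∀ (D : ℕ) (x' : Tor (fine (L ^ n * L ^ K) M)),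
        (∀ y, lam y ≠ 0 → (D : ℝ) ≤ tdistT M (blockOf (L ^ K) M (underPtN L K n M x')) (blockOf (L ^ K) M y)) →
        |((L ^ n * L ^ K : ℕ) : ℝ) *
              (((fineOp (L ^ n * L ^ K) M (aK a L (K + n)) (((L ^ n * L ^ K : ℕ) : ℝ) ^ 2) msq)⁻¹
                  *ᵥ (fun y' => lam (underPtN L K n M y'))) (x' + unitVec (fine (L ^ n * L ^ K) M) μ)
                - ((fineOp (L ^ n * L ^ K) M (aK a L (K + n)) (((L ^ n * L ^ K : ℕ) : ℝ) ^ 2) msq)⁻¹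
                  *ᵥ (fun y' => lam (underPtN L K n M y'))) x')
          - ((L ^ K : ℕ) : ℝ) *
              (((fineOp (L ^ K) M (aK a L K) (((L ^ K : ℕ) : ℝ) ^ 2) msq)⁻¹ *ᵥ lam) (underPtN L K n M x' + unitVec (fine (L ^ K) M) μ)
                - ((fineOp (L ^ K) M (aK a L K) (((L ^ K : ℕ) : ℝ) ^ 2) msq)⁻¹ *ᵥ lam) (underPtN L K n M x'))|
          ≤ C * (((L : ℝ) ^ (-(γ / 2))) ^ K) * Real.exp (-(δ * D)) * F := by
  obtain ⟨C, δ, hC, hδ, H⟩ := fullPropDOp_rate_decay_unif (d := d) L hLodd hL ha hm0 hγ0 hγ1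
  refine ⟨C, δ, hC, hδ, ?_⟩
  intro K hK n hn e M _ hM msq hmsq hcap μ lam F hF D x' hsupp
  have h := H K hK n hn e M hM msq hmsq hcap μ (fun y' => lam (underPtN L K n M y')) F (fun y' => hF _) D x'
    (fun y' hy => hsupp _ hy)
  -- the two operators as sums over the fine torus
  have hfine := inv_deriv_mulVec_eq_sum (L ^ n * L ^ K) M (aK a L (K + n)) (((L ^ n * L ^ K : ℕ) : ℝ) ^ 2) msq
    (fun y' => lam (underPtN L K n M y')) x' μ
  have hcoarse : ((L ^ K : ℕ) : ℝ) *
        (((fineOp (L ^ K) M (aK a L K) (((L ^ K : ℕ) : ℝ) ^ 2) msq)⁻¹ *ᵥ lam) (underPtN L K n M x' + unitVec (fine (L ^ K) M) μ)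
          - ((fineOp (L ^ K) M (aK a L K) (((L ^ K : ℕ) : ℝ) ^ 2) msq)⁻¹ *ᵥ lam) (underPtN L K n M x'))
      = ∑ y', (((L ^ n * L ^ K : ℕ) : ℝ) ^ (d + 1))⁻¹ *
          (((L ^ K : ℕ) : ℝ) * (constrainedProp (L ^ K) M (aK a L K) (((L ^ K : ℕ) : ℝ) ^ 2) msq
              (underPtN L K n M x' + unitVec (fine (L ^ K) M) μ) (underPtN L K n M y')
            - constrainedProp (L ^ K) M (aK a L K) (((L ^ K : ℕ) : ℝ) ^ 2) msq (underPtN L K n M x') (underPtN L K n M y')))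
          * lam (underPtN L K n M y') := by
    have hLK : (((L ^ K : ℕ) : ℝ) ^ (d + 1)) ≠ 0 := pow_ne_zero _ (by exact_mod_cast NeZero.ne (L ^ K))
    have hLn : (((L ^ n : ℕ) : ℝ) ^ (d + 1)) ≠ 0 := pow_ne_zero _ (by exact_mod_cast NeZero.ne (L ^ n))
    rw [inv_deriv_mulVec_eq_sum (L ^ K) M _ _ _ lam,
      sum_comp_underPtN L K n M (fun y => (((L ^ n * L ^ K : ℕ) : ℝ) ^ (d + 1))⁻¹ *
        (((L ^ K : ℕ) : ℝ) * (constrainedProp (L ^ K) M (aK a L K) (((L ^ K : ℕ) : ℝ) ^ 2) msq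
            (underPtN L K n M x' + unitVec (fine (L ^ K) M) μ) y
          - constrainedProp (L ^ K) M (aK a L K) (((L ^ K : ℕ) : ℝ) ^ 2) msq (underPtN L K n M x') y)) * lam y),
      Finset.mul_sum]
    refine Finset.sum_congr rfl fun y _ => ?_
    push_cast
    field_simp
    ring
  rw [hfine, hcoarse, ← Finset.sum_sub_distrib]
  refine (le_of_eq ?_).trans h
  congr 1
  exact Finset.sum_congr rfl fun y' _ => by ring

/-- ★ **ENTRY `|G∇*λ|` OF THE PAIR, PRINTED SHAPE**: with `(∇*_μλ)(y) = N·(λ(y − e_μ) − λ(y))` (`N = η⁻¹`) and `(∇′*_μλ′)(y′) = L^nL^K·(λ′(y′ − e_μ) −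
λ′(y′))` on the η′-lattice, for odd `L ≥ 3`, `a > 0`, `m₀² ≥ 0`, `0 ≤ γ < 1` there are `C, δ > 0` such that for EVERY `K, n ≥ 1`, cube `2L^e`, `0 < m²
≤ m₀²`, `μ`, every `λ` on the η-lattice with `|λ| ≤ F`, every `D ∈ ℕ` and fine `x′` with `λ(y) = 0` whenever `|B(x) − B(y)|_M < D` (`x = πx′`):
`|(A₀′⁻¹∇′*_μ(λ∘π))(x′) − (A₀⁻¹∇*_μλ)(x)| ≤ C·(L^{−γ∕2})^K·e^{−δD}·F` — [B9]'s third (3.42) entry SHAPE for the pair at `U ≡ 1`, for the FULL `A = 0`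
fluctuation propagator (PART Q3b at `f′ = λ∘π`; §2 summation by parts + symmetry; part P″ `sum_comp_underPtN`).
[cite: Balaban1985BackgroundPropagators, Thm 3.1 (3.42) p.397 (entry shape); King1986, Theorem 3.3 (3.7) p.658, Prop. 3.8 (3.71) p.664, p.664] -/
theorem fullPropAdjOp_rate_printed (hLodd : Odd L) (hL : 2 ≤ L) {a : ℝ} (ha : 0 < a) {m0sq : ℝ} (hm0 : 0 ≤ m0sq) {γ : ℝ}
    (hγ0 : 0 ≤ γ) (hγ1 : γ < 1) :
    ∃ C δ : ℝ, 0 < C ∧ 0 < δ ∧ ∀ (K : ℕ), 1 ≤ K → ∀ (n : ℕ), 1 ≤ n →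
      ∀ (e : ℕ) (M : Fin (d + 1) → ℕ) [∀ μ, NeZero (M μ)], (∀ μ, M μ = 2 * L ^ e) →
      ∀ (msq : ℝ), 0 < msq → msq ≤ m0sq → ∀ (μ : Fin (d + 1))
      (lam : Tor (fine (L ^ K) M) → ℝ) (F : ℝ), (∀ y, |lam y| ≤ F) → ∀ (D : ℕ) (x' : Tor (fine (L ^ n * L ^ K) M)),
        (∀ y, lam y ≠ 0 → (D : ℝ) ≤ tdistT M (blockOf (L ^ K) M (underPtN L K n M x')) (blockOf (L ^ K) M y)) →
        |((fineOp (L ^ n * L ^ K) M (aK a L (K + n)) (((L ^ n * L ^ K : ℕ) : ℝ) ^ 2) msq)⁻¹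
              *ᵥ (fun y' => ((L ^ n * L ^ K : ℕ) : ℝ) *
                  (lam (underPtN L K n M (y' - unitVec (fine (L ^ n * L ^ K) M) μ)) - lam (underPtN L K n M y')))) x'
          - ((fineOp (L ^ K) M (aK a L K) (((L ^ K : ℕ) : ℝ) ^ 2) msq)⁻¹
              *ᵥ (fun y => ((L ^ K : ℕ) : ℝ) * (lam (y - unitVec (fine (L ^ K) M) μ) - lam y))) (underPtN L K n M x')|
          ≤ C * (((L : ℝ) ^ (-(γ / 2))) ^ K) * Real.exp (-(δ * D)) * F := by
  obtain ⟨C, δ, hC, hδ, H⟩ := fullPropDTOp_rate_decay_unif (d := d) L hLodd hL ha hm0 hγ0 hγ1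
  refine ⟨C, δ, hC, hδ, ?_⟩
  intro K hK n hn e M _ hM msq hmsq hcap μ lam F hF D x' hsupp
  have h := H K hK n hn e M hM msq hmsq hcap μ (fun y' => lam (underPtN L K n M y')) F (fun y' => hF _) D x'
    (fun y' hy => hsupp _ hy)
  -- the two operators as transposed-gradient sums over the fine torus
  have hfine := inv_mulVec_adjDeriv_eq_sum (L ^ n * L ^ K) M (aK a L (K + n)) (((L ^ n * L ^ K : ℕ) : ℝ) ^ 2) msq
    (fun y' => lam (underPtN L K n M y')) x' μ
  have hcoarse : ((fineOp (L ^ K) M (aK a L K) (((L ^ K : ℕ) : ℝ) ^ 2) msq)⁻¹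
          *ᵥ (fun y => ((L ^ K : ℕ) : ℝ) * (lam (y - unitVec (fine (L ^ K) M) μ) - lam y))) (underPtN L K n M x')
      = ∑ y', (((L ^ n * L ^ K : ℕ) : ℝ) ^ (d + 1))⁻¹ *
          (((L ^ K : ℕ) : ℝ) * (constrainedProp (L ^ K) M (aK a L K) (((L ^ K : ℕ) : ℝ) ^ 2) msq
              (underPtN L K n M y' + unitVec (fine (L ^ K) M) μ) (underPtN L K n M x')
            - constrainedProp (L ^ K) M (aK a L K) (((L ^ K : ℕ) : ℝ) ^ 2) msq (underPtN L K n M y') (underPtN L K n M x')))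
          * lam (underPtN L K n M y') := by
    have hLK : (((L ^ K : ℕ) : ℝ) ^ (d + 1)) ≠ 0 := pow_ne_zero _ (by exact_mod_cast NeZero.ne (L ^ K))
    have hLn : (((L ^ n : ℕ) : ℝ) ^ (d + 1)) ≠ 0 := pow_ne_zero _ (by exact_mod_cast NeZero.ne (L ^ n))
    rw [inv_mulVec_adjDeriv_eq_sum (L ^ K) M _ _ _ lam,
      sum_comp_underPtN L K n M (fun y => (((L ^ n * L ^ K : ℕ) : ℝ) ^ (d + 1))⁻¹ *
        (((L ^ K : ℕ) : ℝ) * (constrainedProp (L ^ K) M (aK a L K) (((L ^ K : ℕ) : ℝ) ^ 2) msq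
            (y + unitVec (fine (L ^ K) M) μ) (underPtN L K n M x')
          - constrainedProp (L ^ K) M (aK a L K) (((L ^ K : ℕ) : ℝ) ^ 2) msq y (underPtN L K n M x'))) * lam y),
      Finset.mul_sum]
    refine Finset.sum_congr rfl fun y _ => ?_
    push_cast
    field_simp
    ring
  rw [hfine, hcoarse, ← Finset.sum_sub_distrib]
  refine (le_of_eq ?_).trans h
  congr 1
  exact Finset.sum_congr rfl fun y' _ => by ring

end Summit.QuantumFields.YangMills.BalabanUVNodes.N15KingModelRung.Curved
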